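import Summits.NavierStokesRegularity.NavierStokesRegularity.Theses.AxisymmetricExtremality
import Summits.NavierStokesRegularity.NavierStokesRegularity.Theorems.AxisymmetricExtremalityAxisymmetricKatoGlobalNoSwirlStratum
import Summits.NavierStokesRegularity.NavierStokesRegularity.Theorems.AxisymmetricSwirlRegularity
import Literature.Analysis.FluidPDE.NSKatoToClayHolds
import Summits.NavierStokesRegularity.NavierStokesRegularity.Theorems.AxisymmetricExtremalityClayDatumCritical

/-!
# Strategist census s20-g21 — typed objects for the STRATEGY CENSUS of the crux
# `AxisymmetricExtremality.AxisymmetricKatoGlobal` (stmt-NavierStokesRegularity-15453)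

Sorry-free certification of the objects named in `STRATEGY-CENSUS-s20-g21.md`:

* §W1 `NoAxisymMinimalBlowup` — the THRESHOLD INSTANCE of the crux (the only instance `closes`
  consumes), with `closes_threshold` (the route's deciding theorem re-glued on it, pure logic) and
  `noAxisymMinimalBlowup_of_crux` (it is formally weaker than the crux);
  `global_below_threshold` — every datum strictly below `ρ_max^pure(ν)` is already global (tree,
  by definition of the threshold), so the instance is exactly the closedness endpoint of a segment of
  global data (barrier `Literature.Barriers.NavierStokesRegularity.ContinuityMethodClosedness`).
* §W2 `hasNoSwirl_of_axisym_reflY` + `noO2SymmetricMinimalBlowup` — the O(2)-instance (axisymmetric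
  AND equivariant under one meridional reflection) is swirl-free, hence decided by the landed
  no-swirl stratum `axisymmetricKatoGlobal_noSwirl_stratum`: a THEOREM, usable only by a route-level
  re-glue that makes the other crux deliver O(2)-symmetric minimal data.
* §W3 `axisymmetricSwirlRegularity_of_crux` — the crux implies the conjecture leaf ns.S25
  (`Summit.…​.AxisymmetricSwirlRegularity`) by proved tree facts (Kato → Clay), so no instance of the
  crux on Clay data is weaker than the named open problem.
* §D `crux_of_bridge` — the best typed split {T := leaf, T → crux (class transfer)}: modus ponens.
-/

noncomputable section

open MeasureTheory Set
open Literature.Analysis.FluidPDE Literature.Analysis.FunctionSpaces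
open Summit.NavierStokesRegularity.NavierStokesRegularity.Theses.AxisymmetricExtremality

namespace Summit.NavierStokesRegularity.NavierStokesRegularity.Cruxes.AxisymmetricKatoGlobal.StrategistS20g21

set_option linter.dupNamespace false

local notation "ℝ³" => EuclideanSpace ℝ (Fin 3)
local notation "ℂ³" => EuclideanSpace ℂ (Fin 3)

/-- The axisymmetry clause of the crux, verbatim (`IsAxisymmetric u₀` unfolded). -/
def AxisymClause (u₀ : ℝ³ → ℝ³) : Prop :=
  ∀ (θ : ℝ) (x : ℝ³), u₀ (WithLp.toLp 2 ![Real.cos θ * x 0 - Real.sin θ * x 1,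
    Real.sin θ * x 0 + Real.cos θ * x 1, x 2]) = WithLp.toLp 2 ![Real.cos θ * u₀ x 0 -
    Real.sin θ * u₀ x 1, Real.sin θ * u₀ x 0 + Real.cos θ * u₀ x 1, u₀ x 2]

theorem axisymClause_iff (u₀ : ℝ³ → ℝ³) : AxisymClause u₀ ↔ IsAxisymmetric u₀ := Iff.rfl

/-! ### §W1 — the threshold instance -/

/-- **W1 (threshold instance).** No axisymmetric `Ḣ^{1/2}`-MINIMAL blow-up datum (Rusin–Šverák
class `IsMinimalBlowupDatum`) exists, at any viscosity. This is the only instance of the crux that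
the route's `closes` consumes. -/
def NoAxisymMinimalBlowup : Prop :=
  ∀ ν : ℝ, 0 < ν → ∀ (u₀ : ℝ³ → ℝ³) (g : HomSobolev ℝ³ ℂ³ (1 / 2 : ℝ)),
    IsMinimalBlowupDatum ν u₀ g → AxisymClause u₀ → False

/-- The crux implies its threshold instance (formally weaker). -/
theorem noAxisymMinimalBlowup_of_crux (h : AxisymmetricKatoGlobal) : NoAxisymMinimalBlowup := by
  intro ν hν u₀ g hmin hax
  obtain ⟨hL3, hrep, hdiv, -, hnot⟩ := hmin
  exact hnot (h ν hν u₀ g hL3 hrep hdiv hax)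

/-- **The deciding theorem re-glued on the threshold instance** (pure logic, same proof as the
route's `closes`): the route needs only W1, not the full crux. -/
theorem closes_threshold (h₂ : MinimalDatumPFold) (h₄ : PFoldToAxisymmetric)
    (h₃ : NoAxisymMinimalBlowup) : NavierStokesRegularity := by
  show Literature.NS.NavierStokesExistenceSmoothR3
  intro ν hν u₀ hsm hdiv hdec
  by_contra hno
  obtain ⟨u₁, g, hmin, hax⟩ := h₄ ν hν (h₂ ν hν ⟨u₀, hsm, hdiv, hdec, hno⟩)
  exact h₃ ν hν u₁ g hmin hax

/-- **Why W1 is a closedness endpoint.** Strictly below the threshold every datum of the crux's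
class is global — by the DEFINITION of `ρ_max^pure` (tree lemma); so the crux's content lives on
`‖g‖ₑ ≥ ρ_max^pure(ν)` and W1 is its boundary case `‖g‖ₑ = ρ_max^pure(ν)`: the endpoint of the
segments `s ↦ s • u₀` (`s < 1`) and `κ ↦ Pol u₀ + κ Tor u₀` (`κ < 1`) of GLOBAL data. -/
theorem global_below_threshold {ν : ℝ} {u₀ : ℝ³ → ℝ³} {g : HomSobolev ℝ³ ℂ³ (1 / 2 : ℝ)}
    (hL3 : MemLp u₀ 3 volume) (hrep : g.Represents (EuclideanSpace.complexify ∘ u₀))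
    (hdiv : IsWeaklyDivFree u₀) (hlt : ‖g‖ₑ < rusinSverakRhoMaxPure ν) :
    HasGlobalKatoSolution ν u₀ :=
  hasGlobalKatoSolution_of_lt_rusinSverakRhoMaxPure hL3 hrep hdiv hlt

/-! ### §W2 — the O(2) (dihedral-limit) instance is a theorem -/

/-- Reflection across the meridional plane `{x 1 = 0}`. -/
def reflY (x : ℝ³) : ℝ³ := WithLp.toLp 2 ![x 0, -(x 1), x 2]

@[simp] theorem reflY_apply_zero (x : ℝ³) : reflY x 0 = x 0 := rfl
@[simp] theorem reflY_apply_one (x : ℝ³) : reflY x 1 = -(x 1) := rfl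
@[simp] theorem reflY_apply_two (x : ℝ³) : reflY x 2 = x 2 := rfl

/-- Equivariance under the meridional reflection (together with axisymmetry: `O(2)`-equivariance,
the limit of dihedral `D_p`-equivariance as `p → ∞`). -/
def IsReflYEquivariant (u : ℝ³ → ℝ³) : Prop := ∀ x, u (reflY x) = reflY (u x)

/-- On the meridional plane `{x 1 = 0}` a `reflY`-equivariant field has no `e₁`-component. -/
theorem apply_one_eq_zero_of_reflY {u : ℝ³ → ℝ³} (hu : IsReflYEquivariant u) {y : ℝ³}
    (hy : y 1 = 0) : u y 1 = 0 := by
  have hfix : reflY y = y := by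
    ext i; fin_cases i <;> simp [reflY, hy]
  have h := congrArg (fun v : ℝ³ => v 1) (hu y)
  simp only [hfix, reflY_apply_one] at h
  linarith

/-- **O(2)-equivariant fields are swirl-free**: axisymmetric + equivariant under one meridional
reflection ⇒ `Γ = x₀ u₁ − x₁ u₀ ≡ 0`. (Rotate `x` to the meridional plane by the angle
`−arg (x₀ + i x₁)`; there `u₁ = 0`; the swirl is rotation-invariant.) -/
theorem hasNoSwirl_of_axisym_reflY {u : ℝ³ → ℝ³} (hax : IsAxisymmetric u)
    (hσ : IsReflYEquivariant u) : HasNoSwirl u := by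
  intro x
  by_cases hz : (⟨x 0, x 1⟩ : ℂ) = 0
  · have h0 : x 0 = 0 := by simpa using congrArg Complex.re hz
    have h1 : x 1 = 0 := by simpa using congrArg Complex.im hz
    simp [swirl, h0, h1]
  · set z : ℂ := ⟨x 0, x 1⟩ with hzdef
    have hnorm : ‖z‖ ≠ 0 := norm_ne_zero_iff.2 hz
    have hcos : Real.cos (-Complex.arg z) = x 0 / ‖z‖ := by
      rw [Real.cos_neg, Complex.cos_arg hz]
    have hsin : Real.sin (-Complex.arg z) = -(x 1 / ‖z‖) := by
      rw [Real.sin_neg, Complex.sin_arg]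
    have hsq : ‖z‖ ^ 2 = x 0 ^ 2 + x 1 ^ 2 := by
      rw [Complex.sq_norm, Complex.normSq_apply]; ring
    -- the rotated point lies on the meridional plane
    set θ := -Complex.arg z with hθ
    have hy1 : rotZ θ x 1 = 0 := by
      simp only [rotZ_apply_one, hcos, hsin]
      field_simp
      ring
    -- its `e₁`-component vanishes, and equals `swirl u x / ‖z‖`
    have hu1 : u (rotZ θ x) 1 = 0 := apply_one_eq_zero_of_reflY hσ hy1
    rw [hax θ x, rotZ_apply_one, hcos, hsin] at hu1
    have : (x 0 * u x 1 - x 1 * u x 0) / ‖z‖ = 0 := by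
      rw [← hu1]; ring
    rcases div_eq_zero_iff.1 this with h | h
    · simpa [swirl] using h
    · exact absurd h hnorm

/-- **W2 is decided**: there is no `O(2)`-equivariant (axisymmetric + meridionally symmetric)
minimal blow-up datum — by the landed no-swirl stratum of the crux
(`axisymmetricKatoGlobal_noSwirl_stratum`, Ladyzhenskaya / Ukhovskii–Yudovich / Abidi in the Kato
class). -/
theorem noO2SymmetricMinimalBlowup :
    ∀ ν : ℝ, 0 < ν → ∀ (u₀ : ℝ³ → ℝ³) (g : HomSobolev ℝ³ ℂ³ (1 / 2 : ℝ)),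
      IsMinimalBlowupDatum ν u₀ g → AxisymClause u₀ → IsReflYEquivariant u₀ → False := by
  intro ν hν u₀ g hmin hax hσ
  obtain ⟨hL3, -, hdiv, -, hnot⟩ := hmin
  exact hnot (Theorems.AxisymmetricKatoGlobal.NoSwirlStratum.axisymmetricKatoGlobal_noSwirl_stratum
    ν hν u₀ hL3 hdiv hax (hasNoSwirl_of_axisym_reflY ((axisymClause_iff u₀).1 hax) hσ))

/-! ### §W3 — the crux is at least the named open problem ns.S25 (axisymmetric Clay (A)) -/

/-- `AxisymmetricKatoGlobal` ⇒ the conjecture leaf `AxisymmetricSwirlRegularity` (proved tree facts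
only: a Clay datum is critical, `axisymmetricExtremality_clayDatumCritical_proof`; a global Kato
solution from a Clay datum is a Clay solution, `clay_solution_of_hasGlobalKatoSolution_holds`). -/
theorem axisymmetricSwirlRegularity_of_crux (h : AxisymmetricKatoGlobal) :
    Summit.NavierStokesRegularity.NavierStokesRegularity.AxisymmetricSwirlRegularity := by
  intro ν hν u₀ hsm hdiv hdec hax
  have hdivW : NSWave0.IsDivFree u₀ := fun x => hdiv x
  obtain ⟨hL3, hdivw, g, hrep⟩ :=
    Theorems.axisymmetricExtremality_clayDatumCritical_proof u₀ hsm hdivW hdec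
  have hK : HasGlobalKatoSolution ν u₀ := h ν hν u₀ g hL3 hrep hdivw hax
  obtain ⟨u, p, hsu, hsp, hns, hbe⟩ :=
    clay_solution_of_hasGlobalKatoSolution_holds ν hν u₀ hsm hdivW hdec hK
  obtain ⟨hcl, h0⟩ := isNavierStokesSolution_and_smooth_iff.1 ⟨hns, hsu, hsp⟩
  exact ⟨u, p, hcl, h0, hbe⟩

/-! ### §D — the best typed split is a bridge (modus ponens) -/

/-- The class-transfer half of the bridge split: axisymmetric Clay (A) for Schwartz data ⇒ the crux
for `Ḣ^{1/2} ∩ L³` data (infinite-energy tails; localisation). Open-but-technical; NOT the hard half. -/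
def LeafTransfer : Prop :=
  Summit.NavierStokesRegularity.NavierStokesRegularity.AxisymmetricSwirlRegularity → AxisymmetricKatoGlobal

/-- The bridge split `{T, T → crux}` assembles by modus ponens; `T` (the leaf) remains the whole crux. -/
theorem crux_of_bridge
    (hT : Summit.NavierStokesRegularity.NavierStokesRegularity.AxisymmetricSwirlRegularity)
    (hTr : LeafTransfer) : AxisymmetricKatoGlobal :=
  hTr hT

end Summit.NavierStokesRegularity.NavierStokesRegularity.Cruxes.AxisymmetricKatoGlobal.StrategistS20g21

end
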